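import Summits.Ventures.PercRepro.KroneckerPITLemmas

/-!
# PercRepro — Kronecker polynomial identity testing, III: the theorem (p4, gen 27)

A polynomial identity in two variables `a, b` with integer coefficients is certified by ONE evaluation:
both sides are evaluated at the Kronecker point `a = 2^(K·M)`, `b = 2^K` (big integers, computed by the
kernel with its accelerated `Nat` arithmetic), and **`pitE`** turns the equality of the two integers into the
identity for ALL rational `a, b`, provided the `b`-degree of both sides is `< M` and twice the sum of their
structural ℓ¹ bounds is `< 2^K` (so that the base-`2^K` digits of the difference — bounded by its ℓ¹-norm — are
all zero, `digits_zero`).  Both bounds are computed structurally on the expression, never by expanding a product,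
so a certificate check costs a few big-number operations (`decide +kernel`).  `evalP_nonneg` / `evalP_pos` give
the sign of a data polynomial with non-negative coefficients.
-/

namespace PercRepro.PIT
/-! ## The Kronecker point -/

/-- `kronP` is the evaluation at the Kronecker point `(2^(K·M), 2^K)`. -/
lemma kronP_eq (K M : Nat) (p : Poly) :
    kronP K M p = evalP ((2 : Int) ^ (K * M)) ((2 : Int) ^ K) p := by
  induction p with
  | nil => simp [kronP, evalP]
  | cons t p ih =>
    obtain ⟨ea, eb, c⟩ := t
    simp only [kronP, evalP, ih, Int.cast_id]
    congr 1
    push_cast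
    rw [← pow_mul, ← pow_mul, mul_assoc, ← pow_add]
    congr 2
    ring

/-- entries of the power table. -/
lemma powTabAux_getD (x : Int) (n : Nat) : ∀ (acc : Int) (i : Nat), i ≤ n →
    (powTabAux x acc n).getD i 0 = acc * x ^ i := by
  induction n with
  | zero =>
    intro acc i hi
    have : i = 0 := by omega
    subst this; simp [powTabAux]
  | succ n ih =>
    intro acc i hi
    cases i with
    | zero => simp [powTabAux]
    | succ i =>
      simp only [powTabAux, List.getD_cons_succ]
      rw [ih (acc * x) i (by omega), pow_succ]
      ring

/-- `powTab x n` lists the powers `x^0, …, x^n`. -/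
lemma powTab_getD (x : Int) (n i : Nat) (hi : i ≤ n) : (powTab x n).getD i 0 = x ^ i := by
  unfold powTab
  rw [powTabAux_getD x n 1 i hi, one_mul]

/-- evaluation through power tables is evaluation. -/
lemma evalPT_eq (x y : Int) (p : Poly) (nx ny : Nat) (hx : degAP p ≤ nx) (hy : degBP p ≤ ny) :
    evalPT (powTab x nx) (powTab y ny) p = evalP x y p := by
  induction p with
  | nil => simp [evalPT, evalP]
  | cons t p ih =>
    obtain ⟨ea, eb, c⟩ := t
    simp only [degAP, degBP] at hx hy
    simp only [evalPT, evalP, Int.cast_id]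
    rw [powTab_getD x nx ea (by omega), powTab_getD y ny eb (by omega), ih (by omega) (by omega)]

/-- `kronE` is the evaluation of the expression at the Kronecker point. -/
lemma kronE_eq (K M : Nat) (e : PExpr) :
    kronE K M e = evalE ((2 : Int) ^ (K * M)) ((2 : Int) ^ K) e := by
  induction e with
  | leaf p => exact kronP_eq K M p
  | va => simp [kronE, evalE]
  | vb => simp [kronE, evalE]
  | const c => simp [kronE, evalE]
  | add e₁ e₂ ih₁ ih₂ => simp [kronE, evalE, ih₁, ih₂]
  | mul e₁ e₂ ih₁ ih₂ => simp [kronE, evalE, ih₁, ih₂]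
  | neg e ih => simp [kronE, evalE, ih]
  | comp p ea eb iha ihb =>
    simp only [kronE, evalE]
    rw [evalPT_eq _ _ p _ _ le_rfl le_rfl, iha, ihb]

/-! ## Digits -/

/-- the index of a term. -/
def idx (M : Nat) (t : Term) : Nat := M * t.1 + t.2.1

/-- the `i`-th digit: the sum of the coefficients of the terms of index `i`. -/
def digit (M i : Nat) : Poly → Int
  | [] => 0
  | t :: p => (if idx M t = i then t.2.2 else 0) + digit M i p

/-- a digit is bounded by the ℓ¹-norm. -/
lemma digit_natAbs_le (M i : Nat) (p : Poly) : (digit M i p).natAbs ≤ l1P p := by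
  induction p with
  | nil => simp [digit, l1P]
  | cons t p ih =>
    obtain ⟨ea, eb, c⟩ := t
    simp only [digit, l1P]
    calc ((if idx M (ea, eb, c) = i then c else 0) + digit M i p).natAbs
        ≤ (if idx M (ea, eb, c) = i then c else 0).natAbs + (digit M i p).natAbs := Int.natAbs_add_le _ _
      _ ≤ c.natAbs + l1P p := by
          gcongr
          split_ifs <;> simp

/-- the `a`-exponent is recovered from the index. -/
lemma idx_div (M : Nat) (t : Term) (hb : t.2.1 < M) : idx M t / M = t.1 := by
  unfold idx
  rw [Nat.mul_add_div (by omega)]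
  simp [Nat.div_eq_of_lt hb]

/-- the `b`-exponent is recovered from the index. -/
lemma idx_mod (M : Nat) (t : Term) (hb : t.2.1 < M) : idx M t % M = t.2.1 := by
  unfold idx
  rw [Nat.mul_add_mod]
  exact Nat.mod_eq_of_lt hb

open Finset in
/-- Regrouping the evaluation by the index of the terms. -/
lemma evalP_regroup {R : Type*} [CommRing R] (x y : R) (M N : Nat) (p : Poly)
    (hB : ∀ t ∈ p, t.2.1 < M) (hN : ∀ t ∈ p, idx M t < N) :
    evalP x y p = ∑ i ∈ range N, (digit M i p : R) * x ^ (i / M) * y ^ (i % M) := by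
  induction p with
  | nil => simp [evalP, digit]
  | cons t p ih =>
    have hB' : ∀ s ∈ p, s.2.1 < M := fun s hs => hB s (List.mem_cons_of_mem _ hs)
    have hN' : ∀ s ∈ p, idx M s < N := fun s hs => hN s (List.mem_cons_of_mem _ hs)
    have htB : t.2.1 < M := hB t (List.mem_cons_self ..)
    have htN : idx M t < N := hN t (List.mem_cons_self ..)
    obtain ⟨ea, eb, c⟩ := t
    simp only [evalP, digit, Int.cast_add, add_mul, sum_add_distrib, ← ih hB' hN']
    congr 1
    have : ∀ i ∈ range N, ((if idx M (ea, eb, c) = i then c else 0 : Int) : R) * x ^ (i / M) * y ^ (i % M)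
        = if idx M (ea, eb, c) = i then (c : R) * x ^ (i / M) * y ^ (i % M) else 0 := by
      intro i _
      split_ifs <;> simp
    rw [sum_congr rfl this, sum_ite_eq (range N) (idx M (ea, eb, c))]
    rw [if_pos (mem_range.2 htN), idx_div M (ea, eb, c) htB, idx_mod M (ea, eb, c) htB]

open Finset in
/-- digits bounded by `2^(K−1)` in absolute value with a vanishing base-`2^K` expansion are all zero. -/
lemma digits_zero (K : Nat) :
    ∀ (N : Nat) (g : Nat → Int), (∀ i < N, 2 * (g i).natAbs < 2 ^ K) →
      (∑ i ∈ range N, g i * (2 : Int) ^ (K * i)) = 0 → ∀ i < N, g i = 0 := by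
  intro N
  induction N with
  | zero => intro g _ _ i hi; exact absurd hi (Nat.not_lt_zero _)
  | succ N ih =>
    intro g hg hsum i hi
    have hsplit : (∑ i ∈ range (N + 1), g i * (2 : Int) ^ (K * i))
        = g 0 + (2 : Int) ^ K * ∑ i ∈ range N, g (i + 1) * (2 : Int) ^ (K * i) := by
      rw [sum_range_succ', mul_sum]
      simp only [mul_zero, pow_zero, mul_one]
      rw [add_comm]
      congr 1
      apply sum_congr rfl
      intro j _
      rw [show K * (j + 1) = K + K * j by ring, pow_add]
      ring
    rw [hsplit] at hsum
    have hdvd : (2 : Int) ^ K ∣ g 0 := by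
      have : g 0 = - ((2 : Int) ^ K * ∑ i ∈ range N, g (i + 1) * (2 : Int) ^ (K * i)) := by linarith
      rw [this]
      exact (dvd_mul_right _ _).neg_right
    have h0 : g 0 = 0 := by
      by_contra h
      have h1 : ((2 : Int) ^ K).natAbs ∣ (g 0).natAbs := Int.natAbs_dvd_natAbs.2 hdvd
      have h2 : ((2 : Int) ^ K).natAbs ≤ (g 0).natAbs := Nat.le_of_dvd (Int.natAbs_pos.2 h) h1
      have h3 : ((2 : Int) ^ K).natAbs = 2 ^ K := by simp [Int.natAbs_pow]
      have h4 := hg 0 (Nat.succ_pos N)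
      omega
    have hrest : (∑ i ∈ range N, g (i + 1) * (2 : Int) ^ (K * i)) = 0 := by
      rw [h0, zero_add] at hsum
      exact (mul_eq_zero.1 hsum).resolve_left (by positivity)
    have := ih (fun i => g (i + 1)) (fun i hi => hg (i + 1) (by omega)) hrest
    rcases Nat.eq_zero_or_pos i with rfl | hpos
    · exact h0
    · obtain ⟨j, rfl⟩ : ∃ j, i = j + 1 := ⟨i - 1, by omega⟩
      exact this j (by omega)

/-! ## The theorem -/

open Finset in
/-- **Kronecker PIT.** If two expressions have `b`-degree `< M`, ℓ¹-norms with `2·(ℓ¹₁ + ℓ¹₂) < 2^K`, and the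
same value at the Kronecker point `(2^(K·M), 2^K)`, they agree at every rational point. -/
theorem pitE (K M : Nat) (e₁ e₂ : PExpr) (hM₁ : degBE e₁ < M) (hM₂ : degBE e₂ < M)
    (hK : 2 * (l1E e₁ + l1E e₂) < 2 ^ K) (hk : kronE K M e₁ = kronE K M e₂) (x y : ℚ) :
    evalE x y e₁ = evalE x y e₂ := by
  set E : Poly := toPoly e₁ ++ negP (toPoly e₂) with hE
  have hB : ∀ t ∈ E, t.2.1 < M := by
    intro t ht
    rw [hE, List.mem_append] at ht
    rcases ht with ht | ht
    · exact lt_of_le_of_lt ((le_degBP ht).trans (degBP_toPoly_le e₁)) hM₁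
    · have : t.2.1 ≤ degBP (negP (toPoly e₂)) := le_degBP ht
      rw [degBP_neg] at this
      exact lt_of_le_of_lt (this.trans (degBP_toPoly_le e₂)) hM₂
  set N : Nat := M * (degAE e₁ + degAE e₂ + 1) with hNdef
  have hN : ∀ t ∈ E, idx M t < N := by
    intro t ht
    have hb := hB t ht
    have ha : t.1 ≤ degAE e₁ + degAE e₂ := by
      rw [hE, List.mem_append] at ht
      rcases ht with ht | ht
      · exact ((le_degAP ht).trans (degAP_toPoly_le e₁)).trans (Nat.le_add_right _ _)
      · have : t.1 ≤ degAP (negP (toPoly e₂)) := le_degAP ht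
        rw [degAP_neg] at this
        exact (this.trans (degAP_toPoly_le e₂)).trans (Nat.le_add_left _ _)
    unfold idx
    rw [hNdef]
    calc M * t.1 + t.2.1 < M * t.1 + M := by omega
      _ = M * (t.1 + 1) := by ring
      _ ≤ M * (degAE e₁ + degAE e₂ + 1) := Nat.mul_le_mul_left _ (by omega)
  have hl1 : l1P E ≤ l1E e₁ + l1E e₂ := by
    rw [hE, l1P_append, l1P_neg]
    exact Nat.add_le_add (l1P_toPoly_le e₁) (l1P_toPoly_le e₂)
  -- the Kronecker value of `E` vanishes
  have hkE : evalP ((2 : Int) ^ (K * M)) ((2 : Int) ^ K) E = 0 := by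
    rw [hE, evalP_append, evalP_neg, evalP_toPoly, evalP_toPoly, ← kronE_eq, ← kronE_eq, hk]
    ring
  -- hence all digits vanish
  have hdig : ∀ i < N, digit M i E = 0 := by
    apply digits_zero K N (fun i => digit M i E)
    · intro i _
      have := digit_natAbs_le M i E
      omega
    · rw [evalP_regroup _ _ M N E hB hN] at hkE
      simp only [Int.cast_id] at hkE
      rw [← hkE]
      apply sum_congr rfl
      intro i _
      rw [← pow_mul, ← pow_mul, mul_assoc, ← pow_add]
      congr 2
      rw [mul_assoc, ← mul_add, Nat.div_add_mod]
  -- so `E` evaluates to zero everywhere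
  have hev : evalP x y E = 0 := by
    rw [evalP_regroup x y M N E hB hN]
    apply sum_eq_zero
    intro i hi
    rw [hdig i (mem_range.1 hi)]
    simp
  rw [hE, evalP_append, evalP_neg, evalP_toPoly, evalP_toPoly] at hev
  linarith

/-- Non-negative coefficients give a non-negative value at non-negative arguments. -/
def allNonneg : Poly → Bool
  | [] => true
  | (_, _, c) :: p => (0 ≤ c) && allNonneg p

/-- Non-negative coefficients give a non-negative value at non-negative arguments. -/
lemma evalP_nonneg (p : Poly) (h : allNonneg p = true) (x y : ℚ) (hx : 0 ≤ x) (hy : 0 ≤ y) :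
    0 ≤ evalP x y p := by
  induction p with
  | nil => simp [evalP]
  | cons t p ih =>
    obtain ⟨ea, eb, c⟩ := t
    simp only [allNonneg, Bool.and_eq_true, decide_eq_true_eq] at h
    simp only [evalP]
    have := ih h.2
    have hc : (0 : ℚ) ≤ c := by exact_mod_cast h.1
    positivity

/-- With a positive constant term in front and non-negative coefficients behind, the value is positive. -/
lemma evalP_pos (p : Poly) (c : Int) (hc : 0 < c) (h : allNonneg p = true) (x y : ℚ) (hx : 0 ≤ x) (hy : 0 ≤ y) :
    0 < evalP x y ((0, 0, c) :: p) := by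
  simp only [evalP, pow_zero, mul_one]
  have := evalP_nonneg p h x y hx hy
  have hc' : (0 : ℚ) < c := by exact_mod_cast hc
  linarith

end PercRepro.PIT
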